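import Mathlib

/-!
# `PulseCalculus` / Negative: the summability hypothesis of the local Helfand lemma is load-bearing

Support file (`--supports stmt-AtomisticToContinuum-15385`) of the disprover seat of the crux
`CoercivePulse.PulseCalculus`, about the pure real-analysis stub `stub_helfandLocal` (S3) of line
`Sketch` (`Cruxes/PulseCalculus/Lines/Sketch.lean`). The stub is TRUE as stated (one dominated
exchange `Σ_x ∫_{(0,t]}` and the summation by parts `Σ_x x²ΔG = 2Σ_xG`). What is landed here is that its
hypothesis (iii) `∀ t, Σ_x (1+x²)|S(x,t)| < ∞` cannot be dropped — not because the mathematics changes but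
because the conclusion is phrased with `tsum`, whose junk value `0` on non-summable families makes the
identity false:

* `not_summable_sq_mul` — `x ↦ x²·c x` is not summable over `ℤ` once `1 ≤ c x` for `2 ≤ |x|`;
* `helfandLocal_false_without_summableS` — the stub with (iii) deleted (verbatim otherwise) is FALSE:
  `G(x,u) = δ₀(x)`, `S(x,t) = 1 + (t²/2)ΔG(x)`; the per-site law and the `G`-majorant hold, both
  `x²`-weighted sums diverge (junk `0`), and at `t = 1` the identity would read `0 - 0 = 2∫₀¹(1-u)du = 1`.

Mathlib only; no definitions. cdisprove seat refuter-cdisprove-stmt-AtomisticToContinuum-15385-0,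
2026-08-17.
-/

noncomputable section

namespace Summit.AtomisticToContinuum.FouriersLaw.Theorems.PulseCalculus.Negative

open MeasureTheory Filter Topology Set

/-- `x ↦ x² · c x` is not summable over `ℤ` as soon as `1 ≤ c x` whenever `2 ≤ |x|` (the terms do not
tend to `0` along the cofinite filter). [folklore] -/
theorem not_summable_sq_mul {c : ℤ → ℝ} (hc : ∀ x : ℤ, 2 ≤ |x| → 1 ≤ c x) :
    ¬ Summable (fun x : ℤ => (x : ℝ) ^ 2 * c x) := by
  intro hs
  have h0 := hs.tendsto_cofinite_zero
  have hev : ∀ᶠ x : ℤ in cofinite, (x : ℝ) ^ 2 * c x < 1 :=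
    h0.eventually (gt_mem_nhds one_pos)
  rw [Filter.eventually_cofinite] at hev
  -- every `x` with `2 ≤ |x|` violates the bound, and there are infinitely many
  have hsub : Set.range (fun n : ℕ => ((n : ℤ) + 2)) ⊆ {x : ℤ | ¬ (x : ℝ) ^ 2 * c x < 1} := by
    rintro x ⟨n, rfl⟩
    have h2 : (2 : ℤ) ≤ |((n : ℤ) + 2)| := by
      rw [abs_of_nonneg (by positivity)]; omega
    have h1 : (1 : ℝ) ≤ c ((n : ℤ) + 2) := hc _ h2
    have hx : (2 : ℝ) ≤ (((n : ℤ) + 2 : ℤ) : ℝ) := by push_cast; linarith [n.cast_nonneg (α := ℝ)]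
    simp only [Set.mem_setOf_eq, not_lt]
    nlinarith
  exact (Set.infinite_range_of_injective (fun a b h => by simpa using h)).mono hsub hev

/-- **Hypothesis (iii) of `stub_helfandLocal` is load-bearing (through junk `tsum`).** The stub of line
`Sketch` with `∀ t, Summable (fun x => (1 + x²) * |S x t|)` deleted is false. Witness: `G(x,u) = δ₀(x)`
(constant in time), `S(x,t) = 1 + (t²/2)ΔG(x)` (so `S(x,0) = 1`): `G(x,·)` is continuous, `F = δ₀` is a
window majorant with finite `(1+x²)`-moment, the per-site law
`S(x,t) - S(x,0) = ∫_{(0,t]}(t-u)ΔG(x,u)du` holds, yet at `t = 1` both `x²`-sums are junk `0` while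
`2∫_{(0,1]}(1-u)Σ_xG(x,u)du = 1`. [folklore] -/
theorem helfandLocal_false_without_summableS :
    ¬ ∀ (S G : ℤ → ℝ → ℝ), (∀ x : ℤ, Continuous (G x)) →
      (∀ τ : ℝ, 0 ≤ τ → ∃ F : ℤ → ℝ, Summable (fun x : ℤ => (1 + (x : ℝ) ^ 2) * F x) ∧
        ∀ t : ℝ, |t| ≤ τ → ∀ x : ℤ, |G x t| ≤ F x) →
      (∀ (x : ℤ) (t : ℝ), 0 < t →
        S x t - S x 0 = ∫ u in Set.Ioc (0:ℝ) t, (t - u) * (G (x + 1) u - 2 * G x u + G (x - 1) u)) →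
      ∀ t : ℝ, 0 < t →
        (∑' x : ℤ, (x : ℝ) ^ 2 * S x t) - (∑' x : ℤ, (x : ℝ) ^ 2 * S x 0) =
          2 * ∫ u in Set.Ioc (0:ℝ) t, (t - u) * ∑' x : ℤ, G x u := by
  intro h
  set g : ℤ → ℝ := fun x => if x = 0 then 1 else 0 with hg
  set G : ℤ → ℝ → ℝ := fun x _ => g x with hG
  set S : ℤ → ℝ → ℝ := fun x t => 1 + t ^ 2 / 2 * (g (x + 1) - 2 * g x + g (x - 1)) with hS
  have hcont : ∀ x : ℤ, Continuous (G x) := fun x => continuous_const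
  have hsumF : Summable (fun x : ℤ => (1 + (x : ℝ) ^ 2) * g x) := by
    refine summable_of_ne_finset_zero (s := {0}) fun x hx => ?_
    rw [Finset.mem_singleton] at hx
    simp [hg, hx]
  have hmaj : ∀ τ : ℝ, 0 ≤ τ → ∃ F : ℤ → ℝ, Summable (fun x : ℤ => (1 + (x : ℝ) ^ 2) * F x) ∧
      ∀ t : ℝ, |t| ≤ τ → ∀ x : ℤ, |G x t| ≤ F x := fun τ _ =>
    ⟨g, hsumF, fun t _ x => by
      simp only [hG, hg]
      split_ifs <;> simp⟩
  have hI : ∀ t : ℝ, 0 < t → ∫ u in Set.Ioc (0:ℝ) t, (t - u) = t ^ 2 / 2 := by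
    intro t ht
    rw [← intervalIntegral.integral_of_le ht.le,
      intervalIntegral.integral_sub intervalIntegrable_const intervalIntegral.intervalIntegrable_id,
      intervalIntegral.integral_const, integral_id]
    simp; ring
  have hper : ∀ (x : ℤ) (t : ℝ), 0 < t →
      S x t - S x 0 = ∫ u in Set.Ioc (0:ℝ) t, (t - u) * (G (x + 1) u - 2 * G x u + G (x - 1) u) := by
    intro x t ht
    simp only [hS, hG, integral_mul_const, hI t ht]
    ring
  have key := h S G hcont hmaj hper 1 one_pos
  -- both weighted sums diverge: junk `0`
  have hΔ : ∀ x : ℤ, 2 ≤ |x| → g (x + 1) - 2 * g x + g (x - 1) = 0 := by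
    intro x hx
    have h1 : x + 1 ≠ 0 := by intro h; rw [show x = -1 by omega] at hx; norm_num at hx
    have h2 : x ≠ 0 := by intro h; rw [h] at hx; norm_num at hx
    have h3 : x - 1 ≠ 0 := by intro h; rw [show x = 1 by omega] at hx; norm_num at hx
    simp [hg, h1, h2, h3]
  have hns1 : ¬ Summable (fun x : ℤ => (x : ℝ) ^ 2 * S x 1) :=
    not_summable_sq_mul fun x hx => by simp only [hS, hΔ x hx]; norm_num
  have hns0 : ¬ Summable (fun x : ℤ => (x : ℝ) ^ 2 * S x 0) :=
    not_summable_sq_mul fun x hx => by simp only [hS]; norm_num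
  rw [tsum_eq_zero_of_not_summable hns1, tsum_eq_zero_of_not_summable hns0] at key
  -- the right-hand side is `1`
  have htg : ∀ u : ℝ, (∑' x : ℤ, G x u) = 1 := fun u => by
    simp only [hG, hg]
    exact tsum_ite_eq 0 1
  simp only [htg, mul_one, hI 1 one_pos] at key
  norm_num at key

end Summit.AtomisticToContinuum.FouriersLaw.Theorems.PulseCalculus.Negative

end
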